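import Literature.NumberTheory.EllipticCurves.Kato2004.MemberHullInputsTwo
import HarnessLib

/-!
# Kato 2004 (Astérisque 295) AT `p = 2`, Kato's member package with the SHARP rank-`0` count: in the count
# R12 of `Kato2004/MemberHullInputsTwo.lean` the two slack factors «`#H¹_F(ℚ,T) ≤ 2^t`» and «Cassels' cokernel
# `≤ 2^t`» are `#B` and `#(S₂(E/ℚ)/B)` for ONE finite group `B = H¹_F(ℚ,T)`, so their product is `#S₂(E/ℚ) = 2^t`
# EXACTLY and the count carries `2·ord₂ #W_K(ℚ)_tors` (BSD's own exponent), not `3·ord₂ #W_K(ℚ)_tors`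

Topic `NumberTheory/EllipticCurves`, sub-directory `Kato2004` (namespace = path). Seat `bsd-2adic-k4-w2` GEN 4
(prover, cell `bsd-2adic`, rung K4, item stmt-BirchSwinnertonDyer-22616 `AdditivePotGoodReducibleRestAtTwo` = the
missing UPPER half at `2` on the `E[2]`-reducible additive potentially-good block). ONE named existence fact
(`def … : Prop`, D-0014), the SHARP twin of `Kato2004.exists_memberHullInputs_two` (same file family, same
structure `Kato2004.MemberHullInputs`, same setting, same witnesses): every hypothesis, every quantifier and the
fields R1–R11 of that fact VERBATIM; only the rank-`0` count (there the structure field `count`, reading step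
R12 = T7″, exponent `3t`) is restated next to the package with the exponent `2t`. Nothing else is touched; the
audited readings `Kato2004/AdditivePotGoodRankZeroShaUpperBoundFineSelmerAtTwo{,Sharp}.lean` (steps T1–T14,
T1′–T7′; D-audit PASS) and the module docstring of `MemberHullInputsTwo.lean` (R1–R12) are the context and are not
repeated. Flag for the referee (lit-kato format):
`Kato-12.4-12.6-13.10-14.14-member-hull-reading-reducible-at-two-SHARP-COUNT` (audit as a DIFF against the flag
`Kato-12.4-12.6-13.10-14.14-member-hull-reading-reducible-at-two`: the only new non-verbatim step is R12♯ below).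

## Setting and notation (as in `MemberHullInputsTwo.lean`)

`E := W_K` Kato's member (globally minimal, `ℚ`-isogenous to the given curve, `T = T₂E ≅ V_{ℤ₂}(f)(1)`), NON-CM,
ADDITIVE and POTENTIALLY GOOD at `2`, `E[2]` REDUCIBLE, `L(E,1) ≠ 0`, `Ш(E/ℚ)` finite; `W = E[2^∞]`,
`2^t = #E(ℚ)[2^∞]` (`t = ord₂ #E(ℚ)_tors`), `2^{t₂} = #E(ℚ₂)[2^∞]`, `r_∞ ∈ {0,1}`; `Σ = {2, ∞} ∪ {ℓ ∣ N}`;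
`A = H¹(ℤ[1/2],T)` = the classes of `H¹(G_Σ,T)` unramified at every odd `ℓ` (Kato 8.2, `j_*`; the pinned field
`A`); `S₂(E/ℚ) := H¹_f(ℚ,T)` the compact (Bloch–Kato) Selmer group of `T` — `H¹_f` at `2`, `H¹_f = H¹` at every odd
`ℓ` and at `∞` —, of order `2^t` in rank `0` with `Ш[2^∞]` finite (`0 → E(ℚ) ⊗ ℤ₂ → S₂ → T₂Ш → 0`; the archimedean
condition of `lim_n Sel_{2^n}` is all of `H¹(ℝ,T) ≅ (ℤ/2)^{r_∞}`, the image of `π₀(E(ℝ))`); Selmer structures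
(Mazur–Rubin) on `T`: `G` = (all at `2`, all at `∞`, `H¹_ur` at `ℓ`), `F` = (`H¹_f` at `2`, all at `∞`, `H¹_ur` at
`ℓ`), `F₀` = (`H¹_f` at `2`, all at `∞`, ALL at `ℓ`); so `H¹_G(ℚ,T) = A`, `H¹_{F₀}(ℚ,T) = S₂(E/ℚ)` and
**`B := H¹_F(ℚ,T) = A ∩ S₂(E/ℚ)`** (one and the same subgroup of `H¹(G_Σ,T)`); duals on `W`:
`H¹_{G*}(ℚ,W) = Sel^{str}(W)` (`0` at `2` and `∞`, `H¹_ur` at `ℓ`), `H¹_{F*}(ℚ,W) = S₁(W)` (`H¹_f` at `2`, `0` at `∞`,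
`H¹_ur` at `ℓ`), `H¹_{F₀*}(ℚ,W) = Sel_{2^∞}(E/ℚ) = Ш(E/ℚ)[2^∞]` (`H¹_f` at `2`, `0` at `∞`, `0 = H¹_f(ℚ_ℓ,W)` at `ℓ`;
rank `0`) — the unramified conditions at `ℓ ≠ 2` on `T` and on `W` being exact annihilators of each other (Milne
*ADT* I.2.6 / NSW (7.2.15) at every finite level `T/2^n`, `W[2^n]`, and `H¹_ur(ℚ_ℓ,T) = lim_n H¹_ur(ℚ_ℓ,T/2^n)`,
`H¹_ur(ℚ_ℓ,W) = colim_n H¹_ur(ℚ_ℓ,W[2^n])`), exactly as used in R12 (i) and (iv) and in T7′.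

## The reading step R12♯ (replaces R12 (v); R12 (i)–(iv) are kept, two of them in their EXACT form)

* **(i) = R12 (i)** (Poitou–Tate for `F ≤ G`, Rubin Thm. I.7.3 / Mazur–Rubin Thm. 2.3.4, exact at `p = 2` with
  `∞ ∈ Σ`): `0 → B → A →loc_s H¹_s(ℚ₂,T) → S₁(W)^∨ → Sel^{str}(W)^∨ → 0`, `H¹_s = H¹/H¹_f`. Here `B = H¹_F(ℚ,T)` IS the
  torsion subgroup of `A`: it is finite (`B ⊂ S₂(E/ℚ)`, finite), hence torsion; and `A_tors ⊂ B` because torsion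
  classes lie in `H¹_f(ℚ₂,T)`. [`B` need NOT be all of `H¹(G_Σ,T)_tors = δ(E(ℚ)[2^∞])`: for `P ∈ E(ℚ)[2^∞]` and an
  odd `ℓ`, `δ(P)` is unramified at `ℓ` iff `P ∈ (W^{I_ℓ})_div = 𝓔⁰(ℤ_ℓ^{ur})[2^∞]` (connecting map of
  `0 → T → V → W → 0` on `I_ℓ`; `W^{I_ℓ}/(W^{I_ℓ})_div ≅ Φ_ℓ(𝔽̄_ℓ)[2^∞]`, SGA 7 IX), i.e. iff `P` meets the identity
  component at `ℓ`; so `#B = 2^{t − x}` with `2^x := #im(E(ℚ)[2^∞] → ∏_{ℓ odd} Φ_ℓ(𝔽_ℓ)[2^∞])`, and `x > 0` happens —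
  e.g. an odd additive `ℓ` with `Φ_ℓ(𝔽_ℓ)[2] ∋` the image of the rational `2`-torsion point. In Prop. 14.16 (2) Kato
  writes this factor as `#H⁰(ℚ, T ⊗ ℚ/ℤ)` («`H¹_f(ℤ[1/p],T)` coincides with the torsion part `H⁰(ℚ,T⊗ℚ/ℤ)` of
  `H¹(ℤ[1/p],T)»`, p. 244, l. −4): that is `#A_tors`, and it equals `#H⁰(ℚ,W) = 2^t` precisely when `x = 0` — the case
  of every lattice Kato applies 14.16 (2) to (14.20–14.21: the image contains `SL₂(ℤ_p)`, `H⁰(ℚ,W) = 0`) and of the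
  two audited readings (`E(ℚ)[2] = 0`). Nothing below uses the value of `#B`.]
* **(ii) = R12 (ii), kept EXACT:** `ord₂ #(A/ℤ₂y₀) = ord₂ #B + e + t₂ − v₂(c₂) + ord₂ #Sel^{str}(W) − ord₂ #S₁(W)`,
  `e = ord₂ exp*_ω(loc₂ y₀) = v₂(lam(0)) + ord₂(L(E,1)/Ω_E)` (R10; `[H¹_s(ℚ₂,T) : ℤ₂ loc_s y₀] = 2^{e + t₂ − v₂(c₂)}`
  by T8; `[H¹_s(ℚ₂,T) : loc_s A] = #S₁/#Sel^{str}` by (i); `B ∩ ℤ₂y₀ = 0`).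
* **(iii) = R12 (iii)** (unchanged, an inequality): `ord₂ #(K/XK) ≥ ord₂ #H²(ℤ[1/2],T) − r_∞ ≥ ord₂ #Sel^{str}(W) + t₂ − t`.
* **(iv) = R12 (iv), kept EXACT** (Poitou–Tate for `F₀* ≤ F*` on `W`, the same theorem; Greenberg LNM 1716
  Prop. 4.13 «Cassels» / Flach): `0 → Sel_{2^∞}(E/ℚ) → S₁(W) → ⊕_{ℓ odd} H¹_ur(ℚ_ℓ,W)/H¹_f(ℚ_ℓ,W) → S₂(E/ℚ)^∨ →
  B^∨ → 0` is exact — the dual Selmer groups of `F₀*` and `F*` on the `T`-side are `H¹_{F₀}(ℚ,T) = S₂(E/ℚ)` and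
  `H¹_F(ℚ,T) = B`, THE SAME `B` AS IN (i)–(ii) (same local conditions: `H¹_f` at `2`, all at `∞`, `H¹_ur(ℚ_ℓ,T) =
  H¹_ur(ℚ_ℓ,W)^⊥` at `ℓ`) —, and `#(H¹_ur(ℚ_ℓ,W)/H¹_f(ℚ_ℓ,W)) = #H¹(𝔽_ℓ, W^{I_ℓ}/div) = #Φ_ℓ(𝔽_ℓ)[2^∞] = 2^{v₂(c_ℓ)}`
  (Kato §14.8). Hence Cassels' cokernel is `(S₂(E/ℚ)/B)^∨`, of order `2^t/#B` (not merely `≤ 2^t`), and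
  **`ord₂ #Ш(E/ℚ)[2^∞] + Σ_{ℓ odd} v₂(c_ℓ) = ord₂ #S₁(W) + t − ord₂ #B`.**
* **(v)♯ (the count).** Substituting (iv) into (ii), `ord₂ #B` CANCELS:
  `ord₂ #(A/ℤ₂y₀) = e + t₂ − v₂(c₂) + ord₂ #Sel^{str}(W) + t − ord₂ #Ш[2^∞] − Σ_{ℓ odd} v₂(c_ℓ)`, i.e.
  `ord₂ #Ш[2^∞] + v₂(Tam E) + ord₂ #(A/ℤ₂y₀) = e + t + (ord₂ #Sel^{str}(W) + t₂) ≤ e + t + (ord₂ #(K/XK) + t)` by (iii):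
  **`ord₂ #Ш(E)[2^∞] + v₂(Tam E) + ord₂ #(A/ℤ₂y₀) ≤ ord₂(L(E,1)/Ω_E) + v₂(lam(0)) + ord₂ #(K/XK) + 2t`** — the field
  `count` of `MemberHullInputs` with `2·ord₂ #E(ℚ)_tors` in place of `3·ord₂ #E(ℚ)_tors`. R12 (v) added the separate
  bounds `#B ≤ 2^t` (in (ii)) and `#(S₂/B) ≤ 2^t` (in (iv)); their product is `#S₂ = 2^t`, whence the third `t` there.
  With `Λ'·ι(𝐲̄) = ℤ₂y₀` and through the tree's PROVED hull descent
  (`Kato2004.valuation_add_padicValNat_coinvariants_le_of_hull_smul`: the `lam(0)` and `K/XK` terms cancel against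
  `#(A/ℤ₂y₀)`) the net consequence is the member bound
  `ord₂ #Ш(W_K)[2^∞] + v₂ Tam(W_K) ≤ ord₂(L(W_K,1)/Ω(W_K)) + 2·ord₂ #W_K(ℚ)_tors`, i.e. — `#Ш_an = L(E,1)·#tors²/(Ω·Tam)`
  in rank `0` — EXACTLY the upper half `ord₂ #Ш(W_K) ≤ ord₂ #Ш_an(W_K)` of BSD₂ at Kato's member, with no slack
  (consumer: `Summits/BirchSwinnertonDyer/BirchSwinnertonDyer/Theorems/ByReductionTypeAtTwoAdditiveReducibleKatoMemberSharp.lean`,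
  which transports it to every curve of the isogeny class by Cassels' invariance of `#Ш_an/#Ш`).

WHAT THE FACT DOES AND DOES NOT PIN: exactly as `exists_memberHullInputs_two` (the package `K` is the same
structure with the same intended witnesses R1–R11; `K.count` — the `3t` form — is implied by and weaker than the
sharp count stated beside it; the one-line implication «sharp fact ⟹ `exists_memberHullInputs_two`» is the consumer's `AddKatoTwo.exists_memberHullInputs_two_of_sharp`). The content certified by review is the
TRANSCRIPTION R1–R11 (audited) plus the bookkeeping identity R12♯ (iv)–(v) (elementary: one finite group `B` occurs
twice); not a new theorem of Iwasawa theory. Statement (A) at `(W_K, 2)` stays a DISPLAYED hypothesis (a theorem from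
print for reducible `E[2]`: Lim 2017 Thm. 3.5 at `2` + Ferrero–Washington; tree `AddKatoTwo.conjA_two_of_not_irreducible`).

## What is NOT here

Everything listed under «What is NOT here» in `MemberHullInputsTwo.lean` (nothing for irreducible `E[2]`, at a
potentially multiplicative `2`, in analytic rank `1`, for CM curves; no claim which curve `W_K` is; no `_holds`,
size XL); no equality form of the count (the Iwasawa-side input (iii) and the hull descent are inequalities); no
lower bound; no use of the value `#B = 2^{t−x}`. No `instance`, no notation. Derivation memo (with the worked check
`11a1, p = 5`: `B = 0`, `S(T) = 0`, `x = t = 1`): `run/shared/lean/pub/bsd-2adic/k4w2/gen4/READING-hMH2sharp-count-2t.md`.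

## References

* K. Kato, Astérisque 295 (2004): §8.2 (pp. 180–181: `H^q(R,T) := lim_n H^q(R, j_*(T/p^n))`), Thm. 12.4 (1)(2),
  Thm. 12.5 (1)–(3), Thm. 12.6, Rem. 12.7 (pp. 221–222), 13.8–13.10, 13.13–13.14 (pp. 227–234), Thm. 14.5 (1)(2)
  (pp. 236–237), §14.8 (pp. 238–239: `S(K,T)`, `Sel ⊂ S`, `S/Sel ↪ ⊕_v H¹(𝔽_v, H⁰(K_v^{ur},T⊗ℚ/ℤ)/div)`),
  (14.9.1)–(14.9.6) (pp. 239–240), §14.14–Lemma 14.15 (pp. 243–244), Prop. 14.16 and its proof (pp. 244–245, the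
  sentence on `H¹_f(ℤ[1/p],T)` at p. 244) — store text `paper:doi-10-24033-ast-639`, read 2026-08-28. [Kato2004Asterisque]
* B. Mazur, K. Rubin, Mem. AMS 799 (2004), Thm. 2.3.4; K. Rubin, *Euler Systems* (2000), Ch. I §3–§4, Prop. 1.4.3,
  Lemma 1.3.5, Thm. I.7.3; Ch. II Thm. 2.3. [MazurRubin2004] [Rubin2000]
* R. Greenberg, LNM 1716 (1999): Prop. 4.13 and the «Cassels' theorem» paragraph; §3 after Lemma 3.3. [GreenbergLNM1716]
* J. S. Milne, *Arithmetic Duality Theorems* (2nd ed.), I.2.6, I.4.10, I.7.3, II §3. [MilneADT2006]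
* J. Neukirch, A. Schmidt, K. Wingberg, *Cohomology of Number Fields* (2nd ed.), (7.2.15), (1.5.6)–(1.5.7). [NeukirchSchmidtWingberg2008]
* A. Grothendieck, SGA 7 I, Exp. IX, §11 (`E[p^∞]^{I_ℓ}` and the component group, `ℓ ≠ p`); J. H. Silverman, *AEC*
  (2nd ed.) VII.6.1, C.§15–16; *Advanced Topics* IV.9. [SilvermanAdvancedTopics1994] [SilvermanAEC2009]
* S. Bloch, K. Kato (1990), §3: Def. 3.10, Ex. 3.11, Prop. 3.8. [BlochKato1990]
* M. F. Lim, Asian J. Math. 21 (2017), Thm. 3.5; J. Coates, R. Sujatha, Math. Ann. 331 (2005), statement (A). [Lim2017FineSelmer] [CoatesSujatha2005]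
* Tree: `Kato2004/MemberHullInputs.lean` (the structure; the odd-`p` reading and its remark «the cell's sharp reading
  M3♯ with 2t is NOT transcribed»), `Kato2004/MemberHullInputsTwo.lean` (R1–R12; its closing TODO names «the sharp
  Cassels cokernel `#im(E(ℚ)[2^∞] → ∏_ℓ Φ_ℓ[2^∞])` in place of `2^t`» — R12♯ shows the two corrections are
  complementary), `Kato2004/AdditivePotGoodRankZeroShaUpperBoundFineSelmerAtTwo{,Sharp}.lean` (T1–T14, T1′–T7′).
-/

noncomputable section

open scoped NumberField TensorProduct
open Field IsDedekindDomain CongruenceSubgroup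
open Literature.NumberTheory.GaloisRepresentations
open Literature.NumberTheory.EllipticCurves Literature.NumberTheory.EllipticCurves.ModularForms
open Literature.NumberTheory.EllipticCurves.Kato2004
open Literature.NumberTheory.EllipticCurves.Kato2004.EulerSystemValues Rat.HeightOneSpectrum
open Literature.NumberTheory.EllipticCurves.IwasawaAlgebra

namespace Literature.NumberTheory.EllipticCurves.Kato2004

/-- **Kato 2004 at `p = 2`, Thm. 12.4 (1)(2), 12.5 (1)–(3), 12.6 + Lemma 13.10 (1) + 13.9 + 13.14, §14.14,
Thm. 14.5 (1)(2) and the SHARP rank-`0` count (§14.8 + the proof of Prop. 14.16 (2) run with the EXACT Cassels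
cokernel), AT KATO'S LATTICE `T = V_{ℤ₂}(f)(1)` OF A CURVE WITH A RATIONAL `2`-ISOGENY: the rank-`0` descent inputs
EXIST at Kato's member AND satisfy the count with `2·ord₂ #tors`.**  Verbatim the hypotheses, quantifiers and
witnesses of `exists_memberHullInputs_two` (module docstring there, R1–R11): for every globally minimal NON-CM
elliptic curve `W/ℚ`, ADDITIVE and POTENTIALLY GOOD at `2`, `W[2]` REDUCIBLE, `L(W,1) ≠ 0`, `Ш(W/ℚ)` finite, there is
a GLOBALLY MINIMAL `W_K ∼_ℚ W` (Kato's member, existential) such that, GRANTED statement (A) at `(W_K,2)` (`hA`,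
displayed, not asserted; a theorem from print for reducible `E[2]`), for the newform `f` of `W` and every `ι` there
is an admissible `ZetaBody` datum, and for every cyclotomic `ℤ₂`-tower `κ`, generator `γ`, `I : IwasawaH1Data W_K 2 κ γ`
and THE lift `𝐲 ∈ I.H` of the corestricted zeta classes, there is a package `K : MemberHullInputs W_K 2 κ γ I 𝐲`
(R1–R11, and R12 in its `3t` form as the field `K.count`) which moreover satisfies the SHARP COUNT
`ord₂ #Ш(W_K)[2^∞] + v₂(Tam W_K) + ord₂ #(K.A/Λ·K.ι(𝐲̄)) ≤ ord₂(L(W_K,1)/Ω(W_K)) + v₂(K.lam(0)) + ord₂ #(K.H2/X·K.H2)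
+ 2·ord₂ #W_K(ℚ)_tors` (reading step R12♯ of the module docstring: in the Poitou–Tate count the factor
`#H¹_F(ℚ,T)` of (ii) and Cassels' cokernel `#(S₂(E/ℚ)/H¹_F(ℚ,T))` of (iv) multiply to `#S₂(E/ℚ) = 2^t`). A
CONSTRUCTION fact (D-0014); weaker than what R1–R12♯ give (the identity of `F`, `H2` is forgotten), never
stronger; with `nonempty_iwasawaH1Data` and modularity it yields the SHARP member bound
`ord₂ #Ш(W_K)[2^∞] + v₂ Tam(W_K) ≤ ord₂(L(W_K,1)/Ω(W_K)) + 2·ord₂ #W_K(ℚ)_tors`, i.e. `ord₂ #Ш(W_K) ≤ ord₂ #Ш_an(W_K)`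
(consumer file). Named fact; nothing asserted; no `_holds` expected (size XL). Flag for the referee:
`Kato-12.4-12.6-13.10-14.14-member-hull-reading-reducible-at-two-SHARP-COUNT` (non-verbatim steps: those of
`exists_memberHullInputs_two` and R12♯ (iv)–(v)).
[cite: Kato2004Asterisque, §8.2 (pp. 180–181), Thm. 12.4 (1)(2) (p. 221), Thm. 12.5 (1)–(3) (pp. 221–222), Thm. 12.6 and Rem. 12.7 (p. 222), 13.8–13.10 (pp. 227–230), 13.13–13.14 (pp. 233–234), Thm. 14.5 (1)(2) (pp. 236–237), §14.8 (pp. 238–239), (14.9.1)–(14.9.6) (pp. 239–240), §14.14 and Lemma 14.15 (pp. 243–244), Prop. 14.16 (2) and its proof (pp. 244–245)]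
[cite: MazurRubin2004, Thm. 2.3.4] [cite: Rubin2000, Ch. I §3–§4, Prop. 1.4.3, Thm. I.7.3; Ch. II Thm. 2.3]
[cite: GreenbergLNM1716, Prop. 4.13 and the paragraph following its proof; §3 after Lemma 3.3]
[cite: MilneADT2006, I.2.6, I.4.10, I.7.3, II §3] [cite: NeukirchSchmidtWingberg2008, (7.2.15)]
[cite: BlochKato1990, §3 Def. 3.10, Ex. 3.11, Prop. 3.8]
[cite: Lim2017FineSelmer, §3 Thm. 3.5] [cite: CoatesSujatha2005, statement (A)]
[cite: SilvermanAEC2009, VII.6.1, Prop. III.4.12 with Rem. III.4.13.2, Thm. X.4.14] -/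
def exists_memberHullInputs_two_sharp : Prop :=
  ∀ (W : WeierstrassCurve ℚ) [W.IsElliptic] [W.IsGloballyMinimal], ¬ W.HasCM →
    ¬ W.HasGoodReductionAtPrime 2 → ¬ W.HasMultiplicativeReductionAtPrime 2 →
    0 ≤ padicValRat 2 W.j →
    ¬ W.HasIrreducibleModPGaloisRep 2 →
    W.entireLFunction 1 ≠ 0 → Finite W.sha →
    ∃ (W' : WeierstrassCurve ℚ) (_ : W'.IsElliptic) (_ : W'.IsGloballyMinimal),
      WeierstrassCurve.IsIsogenous W W' ∧
      ∀ [ContinuousSMul ℤ_[2] (W'.tateModule 2)] [Module.Free ℤ_[2] (W'.tateModule 2)]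
        [Module.Finite ℤ_[2] (W'.tateModule 2)],
      (∀ (κ : ZpExtension ℚ 2), κ.IsCyclotomic →
        ∃ (γ : absoluteGaloisGroup ℚ) (D : W'.FineSelmerDualData κ γ),
          Module.Finite ℤ_[2] (RestrictScalars ℤ_[2] (IwasawaAlgebra 2) D.X)) →
      ∀ {N : ℕ} [NeZero N] (f : CuspForm (Gamma0 N) 2), IsNewformOf W f →
      ∀ (ι : (m : ℕ) → (CyclotomicField m ℚ →+* ℂ)),
      ∃ (κ' : ℝ) (Λ' : ∀ (k : ℕ) (r : Finset (HeightOneSpectrum (𝓞 ℚ))),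
          H1 (tateRep W' 2) (cycSubgroup 2 k r) →ₗ[ℤ_[2]] ℚ_[2] ⊗[ℚ] CyclotomicField (cycLevel 2 k r) ℚ)
        (c d a : ℤ) (A : ℕ)
        (z : ∀ (k : ℕ) (r : (cyclotomicLevelsRat 2 (badPlaces c d A N)).Ideals),
          H1 (tateRep W' 2) ((cyclotomicLevelsRat 2 (badPlaces c d A N)).level k r.1))
        (x : ∀ (k : ℕ) (r : (cyclotomicLevelsRat 2 (badPlaces c d A N)).Ideals),
          CyclotomicField (cycLevel 2 k r.1) ℚ),
        κ' ≠ 0 ∧ 0 < A ∧ Int.gcd c (6 * 2 * A) = 1 ∧ Int.gcd d (6 * 2 * N) = 1 ∧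
        ZetaBody W' 2 f ι κ' Λ' c d a A z x ∧
        ∀ (κ : ZpExtension ℚ 2) (γ : absoluteGaloisGroup ℚ) (hκ : κ.IsCyclotomic),
          κ.IsTopGenerator γ →
          ∀ (I : IwasawaH1Data W' 2 κ γ) (y : I.H),
            (∀ n : ℕ, I.proj n y = levelToLayerTwo W' hκ (badPlaces c d A N) n
              (z (n + 2) (cyclotomicLevelsRat 2 (badPlaces c d A N)).idealOne)) →
            ∃ K : MemberHullInputs W' 2 κ γ I y,
              ∃ q : ℚ, W'.entireLFunction 1 / (W'.realPeriodRat : ℂ) = (q : ℂ) ∧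
                (padicValNat 2 (Nat.card (AddCommGroup.primaryComponent W'.sha 2)) : ℤ) +
                    padicValNat 2 W'.tamagawaProduct +
                    padicValNat 2 (Nat.card (K.A ⧸ (IwasawaAlgebra 2) ∙ K.ι (Submodule.Quotient.mk y))) ≤
                  padicValRat 2 q + ((PowerSeries.constantCoeff K.lam).valuation : ℤ) +
                    padicValNat 2 (Nat.card (coinvariants 2 K.H2)) +
                    2 * (padicValNat 2 W'.torsionOrder : ℤ)

end Literature.NumberTheory.EllipticCurves.Kato2004

end
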